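import Literature.NumberTheory.EllipticCurves.KatzPAdicLFunctionCMFieldLocalDataUnramifiedProofs
import HarnessLib

/-!
# Local data of Katz's measure, V: Hsieh's (d1)/(d2) for `ϑ = (a·y + b·x)/2` in a quadratic tower
# `L = K(x)`, `x² = d`, `y = √d_K` — prime by prime, and at the complex embeddings

PROOF-ONLY sequel of files I–IV (no definition, no named fact, no `sorry`). Purpose (route
`BiquadraticEisensteinDescent`, crux stmt-BirchSwinnertonDyer-21341, line `hsieh-lambda`, layer 2; memo
`Cruxes/EisensteinHeartFlatCMInertBadKPrime/INSTANTIATION-L-BIQUADRATIC.md` §ADDENDUM 3). With `K` a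
number field (the Heegner field `K′`), `L = K(x)` with `[L:K] ≤ 2` and `x² = d ∈ ℤ` (`d = d_CM`),
`y ∈ K` with `y² = d_K`, and integers `a, b`, put `2ϑ := a·y + b·x`. THE (d2) IDENTITY
`ordAt w (2ϑ) = differentExponentAt w` holds at a prime `w ∣ ℓ` of `L` with `ℓ ∤ d_K` in each of the
four cells of the recipe (LEFT side: file III; RIGHT side: file IV):

* `hd2_unit` — `ℓ ∤ 2d`, `ℓ ∤ a`, `ℓ ∣ b`: both sides are `0`;
* `hd2_tame` — `ℓ` odd, `ℓ ∥ d`, `ℓ ∣ a`, `ℓ ∤ b`: both sides are `1`;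
* `hd2_dyadic_four` — `ℓ = 2`, `d = −4`, `2 ∥ a`, `2 ∣ b`: both sides are `2`;
* `hd2_dyadic_eight` — `ℓ = 2`, `d = −8`, `4 ∣ a`, `2 ∤ b`: both sides are `3`;
* `hd2_of_cell` — the four cells packaged as one disjunction `RecipeCell`-free statement.

ARCHIMEDEAN SIDE ((d1) and the Σ-positivity input):
* `re_eq_zero_of_sq_eq_neg`, `im_sq_eq_of_sq_eq_neg` — `z² = −r` (`r ≥ 0` real) ⟹ `Re z = 0`, `(Im z)² = r`;
* `re_apply_theta_eq_zero` — **(d1)**: `Re σ(ϑ) = 0` for every `σ : L →+* ℂ` (`d < 0`, `d_K < 0`);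
* `im_apply_theta_pos` — `Im σ(y) > 0` and `a·Im σ(y) > |b|·√(−d)` (`a ≥ 0`) ⟹ `Im σ(ϑ) > 0`
  (so Σ-positivity holds on every `σ` with `Im σ(y) > 0`, e.g. the `σ ∈ Σ` of
  `…SigmaOrientation.inSigma_singleton_iff` when `y` is oriented by `Im φ̄₀(y) > 0`).

References: [cite: Hsieh2014mu, §3.1 (d1) (d2)]; [cite: NeukirchANT1999, Ch. II §3, Ch. III §2];
[cite: SerreLocalFields1979, Ch. III §6 Prop. 13].
-/

set_option autoImplicit false

noncomputable section

open scoped nonZeroDivisors NumberField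

namespace Literature.NumberTheory.EllipticCurves

open NumberField IsDedekindDomain

/-! ## §1 The (d2) identity in the four cells -/

section NonArch

variable {K : Type} [Field K] [NumberField K] (L : Type) [Field L] [NumberField L] [Algebra K L]

omit [NumberField L] in
/-- `y² = d_K` in `K` read in `L`. [cite: NeukirchANT1999, Ch. I §2] -/
theorem sq_algebraMap_eq_discr {y : K} (hy : y ^ 2 = (NumberField.discr K : K)) :
    (algebraMap K L y) ^ 2 = ((NumberField.discr K : ℤ) : L) := by
  rw [← map_pow, hy]; simp

/-- **(d2), UNIT CELL: `ℓ ∤ 2d·d_K`, `ℓ ∤ a`, `ℓ ∣ b` ⟹ `ord_w(a·y + b·x) = 0 = d_w`.**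
[cite: Hsieh2014mu, §3.1 (d2)] [cite: NeukirchANT1999, Ch. III §2] -/
theorem hd2_unit {x : L} {d : ℤ} (hgen : Algebra.adjoin K {x} = ⊤) (hx : x ^ 2 = (d : L))
    {y : K} (hy : y ^ 2 = (NumberField.discr K : K)) {ℓ : ℕ} (hℓ : ℓ.Prime)
    (w : HeightOneSpectrum (𝓞 L)) (hw : ((ℓ : ℕ) : 𝓞 L) ∈ w.asIdeal)
    (h2d : ¬ (ℓ : ℤ) ∣ 2 * d) (hdK : ¬ (ℓ : ℤ) ∣ NumberField.discr K)
    {a b : ℤ} (ha : ¬ (ℓ : ℤ) ∣ a) (hb : (ℓ : ℤ) ∣ b) :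
    ordAt w ((a : L) * algebraMap K L y + (b : L) * x) = differentExponentAt w := by
  have hY := sq_algebraMap_eq_discr L hy
  have hdK0 : NumberField.discr K ≠ 0 := NumberField.discr_ne_zero K
  have hy0 : algebraMap K L y ≠ 0 := by
    intro h; rw [h, zero_pow two_ne_zero, eq_comm, Int.cast_eq_zero] at hY; exact hdK0 hY
  rw [differentExponentAt_eq_zero_of_sq_eq L hgen hx hℓ w hw h2d hdK]
  exact ordAt_lin_eq_zero hℓ w hw hy0 (ordAt_eq_zero_of_sq_eq_intCast hℓ w hw hY hdK)
    (ordAt_nonneg_of_sq_eq_intCast w hx) ha hb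

/-- **(d2), TAME CELL: `ℓ` odd, `ℓ ∥ d`, `ℓ ∤ d_K`, `ℓ ∣ a`, `ℓ ∤ b` ⟹ `ord_w(a·y + b·x) = 1 = d_w`.**
[cite: Hsieh2014mu, §3.1 (d2)] [cite: NeukirchANT1999, Ch. III §2 Thm. (2.6)] -/
theorem hd2_tame {x : L} {d : ℤ} (hx : x ^ 2 = (d : L)) (h2 : Module.finrank K L ≤ 2)
    {y : K} (hy : y ^ 2 = (NumberField.discr K : K)) {ℓ : ℕ} (hℓ : ℓ.Prime) (hℓ2 : ℓ ≠ 2)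
    (w : HeightOneSpectrum (𝓞 L)) (hw : ((ℓ : ℕ) : 𝓞 L) ∈ w.asIdeal)
    (hd : (ℓ : ℤ) ∣ d) (hdd : ¬ ((ℓ : ℤ) ^ 2) ∣ d) (hdK : ¬ (ℓ : ℤ) ∣ NumberField.discr K)
    {a b : ℤ} (ha : (ℓ : ℤ) ∣ a) (hb : ¬ (ℓ : ℤ) ∣ b) :
    ordAt w ((a : L) * algebraMap K L y + (b : L) * x) = differentExponentAt w := by
  have hY := sq_algebraMap_eq_discr L hy
  have hx0 : x ≠ 0 := by
    intro h; rw [h, zero_pow two_ne_zero, eq_comm, Int.cast_eq_zero] at hx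
    rw [hx] at hdd; exact hdd (dvd_zero _)
  have he := ramificationIdx_eq_two_of_sq_eq L hx h2 hℓ w hw hd hdd hdK
  rw [differentExponentAt_eq_one_of_sq_eq L hx h2 hℓ hℓ2 w hw hd hdd hdK]
  exact ordAt_lin_eq_one hℓ w hw he.ge hx0 (ordAt_eq_one_of_sq_eq_intCast hℓ w hw hx hd hdd he)
    (ordAt_nonneg_of_sq_eq_intCast w hY) ha hb

/-- **(d2), DYADIC CELL `d = −4`: `w ∣ 2`, `d_K` odd, `2 ∥ a`, `2 ∣ b` ⟹ `ord_w(a·y + b·x) = 2 = d_w`.**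
[cite: Hsieh2014mu, §3.1 (d2)] [cite: SerreLocalFields1979, Ch. III §6 Prop. 13] -/
theorem hd2_dyadic_four {x : L} (hx : x ^ 2 = -4) (h2 : Module.finrank K L ≤ 2)
    {y : K} (hy : y ^ 2 = (NumberField.discr K : K)) (w : HeightOneSpectrum (𝓞 L))
    (hw : ((2 : ℕ) : 𝓞 L) ∈ w.asIdeal) (hdK : ¬ (2 : ℤ) ∣ NumberField.discr K)
    {a b : ℤ} (ha : (2 : ℤ) ∣ a) (ha4 : ¬ ((2 : ℤ) ^ 2) ∣ a) (hb : (2 : ℤ) ∣ b) :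
    ordAt w ((a : L) * algebraMap K L y + (b : L) * x) = differentExponentAt w := by
  have hY := sq_algebraMap_eq_discr L hy
  have hdK0 : NumberField.discr K ≠ 0 := NumberField.discr_ne_zero K
  have hy0 : algebraMap K L y ≠ 0 := by
    intro h; rw [h, zero_pow two_ne_zero, eq_comm, Int.cast_eq_zero] at hY; exact hdK0 hY
  have he := ramificationIdx_eq_two_of_sq_eq_neg_four L hx h2 w hw hdK
  rw [differentExponentAt_eq_two_of_sq_eq_neg_four L hx h2 w hw hdK]
  exact ordAt_lin_eq_two w hw he (ordAt_eq_of_sq_eq_neg_four w hw hx he) hy0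
    (ordAt_eq_zero_of_sq_eq_intCast Nat.prime_two w hw hY (by exact_mod_cast hdK)) ha ha4 hb

/-- **(d2), DYADIC CELL `d = −8`: `w ∣ 2`, `d_K` odd, `4 ∣ a`, `2 ∤ b` ⟹ `ord_w(a·y + b·x) = 3 = d_w`.**
[cite: Hsieh2014mu, §3.1 (d2)] [cite: SerreLocalFields1979, Ch. III §6 Prop. 13] -/
theorem hd2_dyadic_eight {x : L} (hx : x ^ 2 = -8) (h2 : Module.finrank K L ≤ 2)
    {y : K} (hy : y ^ 2 = (NumberField.discr K : K)) (w : HeightOneSpectrum (𝓞 L))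
    (hw : ((2 : ℕ) : 𝓞 L) ∈ w.asIdeal) (hdK : ¬ (2 : ℤ) ∣ NumberField.discr K)
    {a b : ℤ} (ha : ((2 : ℤ) ^ 2) ∣ a) (hb : ¬ (2 : ℤ) ∣ b) :
    ordAt w ((a : L) * algebraMap K L y + (b : L) * x) = differentExponentAt w := by
  have hY := sq_algebraMap_eq_discr L hy
  have hx0 : x ≠ 0 := by intro h; rw [h] at hx; norm_num at hx
  have he := ramificationIdx_eq_two_of_sq_eq_neg_eight L hx h2 w hw hdK
  rw [differentExponentAt_eq_three_of_sq_eq_neg_eight L hx h2 w hw hdK]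
  exact ordAt_lin_eq_three w hw he hx0 (ordAt_eq_of_sq_eq_neg_eight w hw hx he)
    (ordAt_nonneg_of_sq_eq_intCast w hY) ha hb

/-- **The (d2) identity for `2ϑ = a·y + b·x`, the four cells in one statement**: at a prime `w ∣ ℓ` of
`L = K(x)` (`[L:K] ≤ 2`, `x² = d`, `y² = d_K`, `ℓ ∤ d_K`), if `(ℓ, d, a, b)` is in one of the cells
(unit / tame / dyadic `−4` / dyadic `−8`) then `ordAt w (2ϑ) = differentExponentAt w` for
`ϑ = (a·y + b·x)/2`. [cite: Hsieh2014mu, §3.1 (d2)] -/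
theorem hd2_of_cell {x : L} {d : ℤ} (hgen : Algebra.adjoin K {x} = ⊤) (hx : x ^ 2 = (d : L))
    (h2 : Module.finrank K L ≤ 2) {y : K} (hy : y ^ 2 = (NumberField.discr K : K))
    {ℓ : ℕ} (hℓ : ℓ.Prime) (w : HeightOneSpectrum (𝓞 L)) (hw : ((ℓ : ℕ) : 𝓞 L) ∈ w.asIdeal)
    (hdK : ¬ (ℓ : ℤ) ∣ NumberField.discr K) {a b : ℤ}
    (hcell : (¬ (ℓ : ℤ) ∣ 2 * d ∧ ¬ (ℓ : ℤ) ∣ a ∧ (ℓ : ℤ) ∣ b) ∨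
      (ℓ ≠ 2 ∧ (ℓ : ℤ) ∣ d ∧ ¬ ((ℓ : ℤ) ^ 2) ∣ d ∧ (ℓ : ℤ) ∣ a ∧ ¬ (ℓ : ℤ) ∣ b) ∨
      (ℓ = 2 ∧ d = -4 ∧ (2 : ℤ) ∣ a ∧ ¬ ((2 : ℤ) ^ 2) ∣ a ∧ (2 : ℤ) ∣ b) ∨
      (ℓ = 2 ∧ d = -8 ∧ ((2 : ℤ) ^ 2) ∣ a ∧ ¬ (2 : ℤ) ∣ b)) :
    ordAt w (2 * (((a : L) * algebraMap K L y + (b : L) * x) / 2)) = differentExponentAt w := by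
  rw [mul_div_cancel₀ _ (two_ne_zero' L)]
  rcases hcell with ⟨h2d, ha, hb⟩ | ⟨hℓ2, hd, hdd, ha, hb⟩ | ⟨rfl, rfl, ha, ha4, hb⟩ | ⟨rfl, rfl, ha, hb⟩
  · exact hd2_unit L hgen hx hy hℓ w hw h2d hdK ha hb
  · exact hd2_tame L hx h2 hy hℓ hℓ2 w hw hd hdd hdK ha hb
  · exact hd2_dyadic_four L (by rw [hx]; norm_num) h2 hy w hw (by exact_mod_cast hdK) ha ha4 hb
  · exact hd2_dyadic_eight L (by rw [hx]; norm_num) h2 hy w hw (by exact_mod_cast hdK) ha hb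

end NonArch

/-! ## §2 The archimedean side: (d1) and Σ-positivity -/

section Arch

/-- `z² = −r` with `r ≥ 0` real ⟹ `Re z = 0`. [cite: Hsieh2014mu, §3.1 (d1)] -/
theorem re_eq_zero_of_sq_eq_neg {z : ℂ} {r : ℝ} (hr : 0 ≤ r) (hz : z ^ 2 = -(r : ℂ)) : z.re = 0 := by
  have hre : (z ^ 2).re = -r := by rw [hz]; simp
  have him : (z ^ 2).im = 0 := by rw [hz]; simp
  rw [pow_two, Complex.mul_re] at hre
  rw [pow_two, Complex.mul_im] at him
  -- `2 re·im = 0` and `re² − im² = −r ≤ 0`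
  have h2 : z.re * z.im = 0 := by linarith
  rcases mul_eq_zero.mp h2 with h | h
  · exact h
  · rw [h, mul_zero, sub_zero] at hre
    nlinarith [mul_self_nonneg z.re]

/-- `z² = −r` with `r ≥ 0` real ⟹ `(Im z)² = r`. [cite: Hsieh2014mu, §3.1 (d1)] -/
theorem im_sq_eq_of_sq_eq_neg {z : ℂ} {r : ℝ} (hr : 0 ≤ r) (hz : z ^ 2 = -(r : ℂ)) : z.im ^ 2 = r := by
  have hre0 := re_eq_zero_of_sq_eq_neg hr hz
  have hre : (z ^ 2).re = -r := by rw [hz]; simp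
  rw [pow_two, Complex.mul_re, hre0] at hre
  nlinarith

/-- `|Im z| = √r` when `z² = −r`, `r ≥ 0`. [cite: Hsieh2014mu, §3.1 (d1)] -/
theorem abs_im_eq_sqrt_of_sq_eq_neg {z : ℂ} {r : ℝ} (hr : 0 ≤ r) (hz : z ^ 2 = -(r : ℂ)) :
    |z.im| = Real.sqrt r := by
  rw [← Real.sqrt_sq_eq_abs, im_sq_eq_of_sq_eq_neg hr hz]

variable {L : Type} [Field L]

/-- An element with `x² = d`, `d ≤ 0` an integer, is purely imaginary under every complex embedding.
[cite: Hsieh2014mu, §3.1 (d1)] -/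
theorem re_apply_eq_zero_of_sq_eq_intCast (σ : L →+* ℂ) {x : L} {d : ℤ} (hx : x ^ 2 = (d : L))
    (hd : d ≤ 0) : (σ x).re = 0 := by
  refine re_eq_zero_of_sq_eq_neg (r := ((-d : ℤ) : ℝ)) (by exact_mod_cast neg_nonneg.mpr hd) ?_
  rw [← map_pow, hx, map_intCast]; push_cast; ring

/-- **(d1) for `ϑ = (a·y + b·x)/2`**: `Re σ(ϑ) = 0` for every `σ : L →+* ℂ` when `x² = d ≤ 0` and
`y² = d′ ≤ 0` are integers (`a, b ∈ ℤ`). [cite: Hsieh2014mu, §3.1 (d1)] -/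
theorem re_apply_theta_eq_zero (σ : L →+* ℂ) {x y : L} {d d' : ℤ} (hx : x ^ 2 = (d : L)) (hd : d ≤ 0)
    (hy : y ^ 2 = (d' : L)) (hd' : d' ≤ 0) (a b : ℤ) :
    (σ (((a : L) * y + (b : L) * x) / 2)).re = 0 := by
  have hxr := re_apply_eq_zero_of_sq_eq_intCast σ hx hd
  have hyr := re_apply_eq_zero_of_sq_eq_intCast σ hy hd'
  rw [map_div₀, map_add, map_mul, map_mul, map_intCast, map_intCast, map_ofNat]
  simp [Complex.add_re, Complex.div_ofNat_re, hxr, hyr]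

/-- **Σ-positivity input for `ϑ = (a·y + b·x)/2`**: if `Im σ(y) > 0`, `0 ≤ a` and
`a·Im σ(y) > |b|·|Im σ(x)|`, then `Im σ(ϑ) > 0`. [cite: Hsieh2014mu, §3.1 (d1)] -/
theorem im_apply_theta_pos (σ : L →+* ℂ) {x y : L} {a b : ℤ}
    (h : |(b : ℝ)| * |(σ x).im| < (a : ℝ) * (σ y).im) :
    0 < (σ (((a : L) * y + (b : L) * x) / 2)).im := by
  rw [map_div₀, map_add, map_mul, map_mul, map_intCast, map_intCast, map_ofNat]
  simp only [Complex.add_im, Complex.div_ofNat_im, Complex.mul_im, Complex.intCast_re, Complex.intCast_im,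
    zero_mul, add_zero]
  have hb : -( |(b : ℝ)| * |(σ x).im| ) ≤ (b : ℝ) * (σ x).im := by
    rw [← abs_mul]; exact neg_abs_le _
  linarith

/-- The same with `|Im σ(x)| = √(−d)` made explicit (`x² = d ≤ 0`): `a·Im σ(y) > |b|·√(−d)` suffices.
[cite: Hsieh2014mu, §3.1 (d1)] -/
theorem im_apply_theta_pos_of_sq_eq (σ : L →+* ℂ) {x y : L} {d : ℤ} (hx : x ^ 2 = (d : L)) (hd : d ≤ 0)
    {a b : ℤ} (h : |(b : ℝ)| * Real.sqrt (-(d : ℝ)) < (a : ℝ) * (σ y).im) :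
    0 < (σ (((a : L) * y + (b : L) * x) / 2)).im := by
  refine im_apply_theta_pos σ ?_
  have habs : |(σ x).im| = Real.sqrt (-(d : ℝ)) := by
    refine abs_im_eq_sqrt_of_sq_eq_neg (r := -(d : ℝ)) (by exact_mod_cast neg_nonneg.mpr hd) ?_
    rw [← map_pow, hx, map_intCast]; push_cast; ring
  rwa [habs]

end Arch

end Literature.NumberTheory.EllipticCurves

end
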